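import Summits.NavierStokesRegularity.NavierStokesRegularity.Theorems.SoloSalvageJormakka2010
import Literature.Analysis.FluidPDE.ClassicalSolutionCalculus
import HarnessLib

/-!
# D-0090 NS-CLAIMS, C02 `Jormakka2010` — SALVAGE part 2: the GLOBAL reading of Step 5 is vacuous,
# so the closed-loop headline holds with no Navier–Stokes content

Cell ns-claims, salvage seat `ns-claims-salvage-p2`, solo lane; companion of
`SoloSalvageJormakka2010.lean`. Referee ns-claims-ref-1's finding (3) (RETYPE.md §2 R#3,
2026-08-26T16:46Z), kernel-checked: **no pair `(u, p)` smooth on `ℝ³ × [0,∞)` solves the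
CLOSED-LOOP system of the proof of Theorem 2.4** (force slot = `feedbackForce ν c a u`,
`fᵢ := ∂ₜuᵢ − ∂ₜUᵢ` on `[0,a)`, p. 4), for any `c ≠ 0`, `a > 0`, `ν`. Mechanism (no NS estimate is
used): along a classical solution the force `f = ∂ₜu + (u·∇)u − νΔu + ∇p` is jointly smooth on
`[0,∞) × ℝ³` (tree `IsClassicalNSSolutionOn.isSmoothSpaceTimeOn_force`), hence so is
`∂ₜu − f`, which on `[0, a)` equals `∂ₜU`; so `∂ₜU(·, x₀)` is bounded on `[0, a]`, and by the mean
value inequality `U(·, x₀)` is bounded on `[0, a)` — contradicting `‖U(t, x₀)‖ → ∞`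
(`theorem23Witness_holds`). In words: the realised "force" is not a function on `ℝ³ × [0,∞)` along
ANY global candidate, so the class the headline quantifies over is empty.

Consequences (all kernel theorems, std axioms):
* `theorem24ClosedLoop_holds` — `Theorem24ClosedLoop ν c a` for `c ≠ 0`, `a > 0`, every `ν`;
* `step24Unique_holds` — Step 5′ (GLOBAL reading of p. 5 l. 8–18) holds VACUOUSLY;
  `step24ZeroForceUnique_holds` — Step 4 likewise;
* **`claimedTheorem_holds : ClaimedTheorem`** — the typed headline (Theorem 2.4 in the closed-loop
  reading, `∀ ν > 0, c ≠ 0, a > 1`) is TRUE, vacuously. This is NOT «discharges» in the cell's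
  sense: Step 5 = `Step24UniqueLocal` (the print-faithful LOCAL reading) is FALSE
  (`…Theorems.Jormakka2010.not_step24UniqueLocal`, refuter-2, SoloRefuteJormakka2010.lean), and
  the headline does not reach Clay (D): `clay_of_claimed` is not derivable, the exact bridge
  `ClayDelta` (axis Δ3 FORCE) is now kernel-FALSE (`not_clayDelta`), and (D)'s conclusion fails at
  the exhibited data (`not_clayDInstance`, `not_clayDErrataInstance`, part 1).

WHAT THIS IS NOT: not a claim about NS regularity or blow-up; not a claim about any author beyond
the typed locator.
-/

noncomputable section

-- summit-side namespace convention `Summit.NavierStokesRegularity.NavierStokesRegularity.…` (CONVENTIONS §2)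
set_option linter.dupNamespace false

open Set Function Real Filter
open scoped ContDiff Topology

namespace Summit.NavierStokesRegularity.NavierStokesRegularity.Theorems.Jormakka2010

open Literature.Analysis.FluidPDE Literature.Claims.NS.Jormakka2010

/-- On `[0, a)` the feedback force is `∂ₜu − ∂ₜU` (one-sided time derivatives within `[0,∞)`).
[cite: Jormakka2010, Theorem 2.4 (proof) p.4] -/
theorem feedbackForce_of_lt (ν c a : ℝ) (u : ℝ → EuclideanSpace ℝ (Fin 3) → EuclideanSpace ℝ (Fin 3))
    {t : ℝ} (ht : t < a) (x : EuclideanSpace ℝ (Fin 3)) :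
    feedbackForce ν c a u t x =
      timeDerivWithin (Ici 0) u t x - timeDerivWithin (Ici 0) (blowupVelocity ν c a) t x := by
  simp [feedbackForce, ht]

/-- On `[0, a)` the one-sided time derivative of `U` within `[0, a)` is the one within `[0, ∞)`
(the two time sets agree near every `t < a`). [folklore] -/
private theorem timeDerivWithin_Ico_eq_Ici (ν c a : ℝ) {s : ℝ} (hs : s ∈ Ico 0 a)
    (x : EuclideanSpace ℝ (Fin 3)) :
    timeDerivWithin (Ico 0 a) (blowupVelocity ν c a) s x =
      timeDerivWithin (Ici 0) (blowupVelocity ν c a) s x := by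
  simp only [timeDerivWithin_apply]
  apply derivWithin_congr_set
  refine Filter.eventuallyEq_set.2 ?_
  filter_upwards [Iio_mem_nhds hs.2] with r hr
  exact ⟨fun h => h.1, fun h => ⟨h, hr⟩⟩

/-- **The global reading is vacuous (referee ns-claims-ref-1, RETYPE.md §2 R#3 (3)): the
closed-loop system of the proof of Theorem 2.4 has NO solution smooth on `ℝ³ × [0,∞)`**, for every
`ν`, `c ≠ 0`, `a > 0` — i.e. `Theorem24ClosedLoop ν c a` holds, with no Navier–Stokes content:
along a global classical solution the force is jointly smooth on `[0,∞) × ℝ³`, so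
`∂ₜU = ∂ₜu − f` would be bounded near `t = a`, and then `U(·, x₀)` would be bounded on `[0,a)`
(mean value inequality), contradicting `‖U(t, x₀)‖ → ∞`. [cite: Jormakka2010, Theorem 2.4 pp.4–5] -/
theorem theorem24ClosedLoop_holds (ν : ℝ) {c a : ℝ} (hc : c ≠ 0) (ha : 0 < a) :
    Theorem24ClosedLoop ν c a := by
  rintro ⟨u, p, hu, hp, hns, -⟩
  obtain ⟨hcl, -⟩ := isNavierStokesSolution_and_smooth_iff.1 ⟨hns, hu, hp⟩
  -- `G := ∂ₜu − f` is jointly smooth on `[0,∞) × ℝ³`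
  have hG : IsSmoothSpaceTimeOn (Ici 0)
      (fun t x => timeDerivWithin (Ici 0) u t x - feedbackForce ν c a u t x) :=
    (hcl.smooth_velocity.timeDerivWithin (uniqueDiffOn_Ici 0)).sub
      (hcl.isSmoothSpaceTimeOn_force (uniqueDiffOn_Ici 0))
  set x₀ : EuclideanSpace ℝ (Fin 3) := 0 with hx₀
  -- `G(·, x₀)` is continuous on `[0, a]`, hence bounded there
  have hGc : ContinuousOn (fun t => timeDerivWithin (Ici 0) u t x₀ - feedbackForce ν c a u t x₀)
      (Icc 0 a) := by
    have h1 := hG.continuousOn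
    have h2 : ContinuousOn (fun t : ℝ => ((t, x₀) : ℝ × EuclideanSpace ℝ (Fin 3))) (Icc 0 a) :=
      (continuous_id.prodMk continuous_const).continuousOn
    exact h1.comp h2 fun t ht => ⟨ht.1, mem_univ _⟩
  obtain ⟨M, hM⟩ := isCompact_Icc.exists_bound_of_continuousOn hGc
  have hM0 : 0 ≤ M := le_trans (norm_nonneg _) (hM 0 (left_mem_Icc.2 ha.le))
  -- the Theorem 2.3 witness `U`: smooth on `[0,a)`, datum `u⁰`, blows up as `t → a⁻`
  obtain ⟨hU, hU0, -, hblow⟩ := theorem23Witness_holds ν hc ha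
  -- on `[0, a)`, `∂ₜU = G`
  have hderiv : ∀ s ∈ Ico 0 a, HasDerivWithinAt (fun r => blowupVelocity ν c a r x₀)
      (timeDerivWithin (Ici 0) u s x₀ - feedbackForce ν c a u s x₀) (Ico 0 a) s := by
    intro s hs
    have h1 := hU.smooth_velocity.hasDerivWithinAt_timeDerivWithin (uniqueDiffOn_Ico 0 a) hs x₀
    rw [feedbackForce_of_lt ν c a u hs.2 x₀, sub_sub_cancel, ← timeDerivWithin_Ico_eq_Ici ν c a hs x₀]
    exact h1
  -- mean value inequality on `[0, t]`, `t < a`: `‖U(t, x₀)‖ ≤ ‖u⁰(x₀)‖ + M a`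
  have hbound : ∀ t ∈ Ico 0 a, ‖blowupVelocity ν c a t x₀‖ ≤ ‖initialField x₀‖ + M * a := by
    intro t ht
    have hmv := norm_image_sub_le_of_norm_deriv_le_segment'
      (f := fun r => blowupVelocity ν c a r x₀) (a := 0) (b := t)
      (fun s hs => (hderiv s ⟨hs.1, lt_of_le_of_lt hs.2 ht.2⟩).mono (Icc_subset_Ico_right ht.2))
      (fun s hs => hM s ⟨hs.1, (lt_of_lt_of_le hs.2 ht.2.le).le⟩) t (right_mem_Icc.2 ht.1)
    have h0 : ‖blowupVelocity ν c a 0 x₀‖ = ‖initialField x₀‖ := by rw [hU0]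
    have h1 := norm_le_insert' (blowupVelocity ν c a t x₀) (blowupVelocity ν c a 0 x₀)
    have h2 : M * (t - 0) ≤ M * a := by
      rw [sub_zero]
      exact mul_le_mul_of_nonneg_left ht.2.le hM0
    linarith
  -- contradiction with `‖U(t, x₀)‖ → ∞`
  have hev : ∀ᶠ t in 𝓝[<] a, ‖initialField x₀‖ + M * a < ‖blowupVelocity ν c a t x₀‖ :=
    (hblow x₀).eventually (eventually_gt_atTop _)
  obtain ⟨t, h1, h2⟩ := (hev.and (Ico_mem_nhdsLT ha)).exists
  exact absurd (hbound t h2) (not_le.2 h1)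

/-- **Step 5′ (`Step24Unique`, the GLOBAL reading of p. 5 l. 8–18) holds — vacuously**: there is
no global smooth closed-loop solution to be compared with `U`. (The print-faithful LOCAL reading,
Step 5 = `Step24UniqueLocal`, is FALSE: `not_step24UniqueLocal`, SoloRefuteJormakka2010.lean.)
[cite: Jormakka2010, Theorem 2.4 (proof) p.5] -/
theorem step24Unique_holds (ν : ℝ) {c a : ℝ} (hc : c ≠ 0) (ha : 0 < a) : Step24Unique ν c a :=
  fun u p hsol => absurd ⟨u, p, hsol⟩ (theorem24ClosedLoop_holds ν hc ha)

/-- **Step 4 (`Step24ZeroForceUnique`, p. 5 l. 19–22) holds — vacuously** (same empty class).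
[cite: Jormakka2010, Theorem 2.4 (proof) p.5] -/
theorem step24ZeroForceUnique_holds (ν : ℝ) {c a : ℝ} (hc : c ≠ 0) (ha : 0 < a) :
    Step24ZeroForceUnique ν c a :=
  step24ZeroForceUnique_of_unique (step24Unique_holds ν hc ha)

/-- **The typed headline `ClaimedTheorem` (Theorem 2.4 in the closed-loop reading its proof
argues: `∀ ν > 0, c ≠ 0, a > 1`, no global smooth `u`-periodic solution of the closed-loop
problem) is TRUE — vacuously, with no Navier–Stokes content** (`theorem24ClosedLoop_holds`). It
is not Clay (D): the force slot holds a functional of the unknown whose realised value is not a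
function on `ℝ³ × [0,∞)` along any global candidate; `clay_of_claimed` is not derivable, the
bridge `ClayDelta` is false (`not_clayDelta`), and at the exhibited data (D)'s conclusion fails
(`not_clayDInstance`). [cite: Jormakka2010, Theorem 2.4 p.4] -/
theorem claimedTheorem_holds : ClaimedTheorem :=
  fun ν _ _ _ hc ha => theorem24ClosedLoop_holds ν hc (lt_trans one_pos ha)

/-- **The bridging hypothesis from the headline to Clay (D) is FALSE** (unconditionally): the
Δ3-FORCE identification "open-loop solutions of `(u⁰, f ≡ 0)` are closed-loop solutions" (§4,
p. 13: "a feedback control force is an external force to the controlled system") contradicts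
Lemma 2.1 (`lemma21_holds`) together with the closed-loop headline (`claimedTheorem_holds`).
[cite: Jormakka2010, §4 p.13] -/
theorem not_clayDelta : ¬ ClayDelta :=
  not_clayDelta_of_claimedTheorem claimedTheorem_holds

/-- Bookkeeping for the MAP row: every hypothesis of the skeleton's composition `claim_of_steps`
except Step 5 is now a kernel theorem — Steps 1–3 genuinely (part 1), Steps 4 and 5′ vacuously —
and the composition's conclusion holds outright; the paper's route to it through Step 5 is not
needed and Step 5 itself is false. [cite: Jormakka2010, Theorem 2.4 pp.4–5] -/
theorem claim_of_steps_inputs :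
    (∀ ν : ℝ, 0 < ν → Lemma21 ν) ∧
    (∀ ν : ℝ, 0 < ν → ∀ c a : ℝ, c ≠ 0 → 1 < a → Theorem23Witness ν c a) ∧
    (∀ ν : ℝ, 0 < ν → ∀ c a : ℝ, c ≠ 0 → 1 < a → Step24Solves ν c a) ∧
    (∀ ν : ℝ, 0 < ν → ∀ c a : ℝ, c ≠ 0 → 1 < a → Step24ZeroForceUnique ν c a) ∧
    (∀ ν : ℝ, 0 < ν → ∀ c a : ℝ, c ≠ 0 → 1 < a → Step24Unique ν c a) :=
  ⟨fun ν _ => lemma21_holds ν,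
    fun ν _ _ _ hc ha => theorem23Witness_holds ν hc (lt_trans one_pos ha),
    fun ν _ _ _ hc ha => step24Solves_holds ν hc (lt_trans one_pos ha),
    fun ν _ _ _ hc ha => step24ZeroForceUnique_holds ν hc (lt_trans one_pos ha),
    fun ν _ _ _ hc ha => step24Unique_holds ν hc (lt_trans one_pos ha)⟩

end Summit.NavierStokesRegularity.NavierStokesRegularity.Theorems.Jormakka2010

end

-- WHAT THIS IS NOT: not a claim about NS regularity or blow-up; not a claim about any author beyond the
-- typed locator.
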